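import Mathlib
import HarnessLib
import Literature.Computability.AlgebraicComplexity.MignonRessayreBound
import Literature.LinearAlgebra.Matrix.HadamardProductRank

/-!
# Hadamard certificates for colour-disjoint rectangles (line rank-dehn-ladder, stub `stub_cutLemma`)

Crux `stmt-PneNP-18923` (`Summit.PneNP.PneNP.Theses.CnfIdealGenLength.RankDefectRepresentations`), line
`rank-dehn-ladder`, negative rung N1 (`stub_cutLemma`, OPEN; RECT form of
`Cruxes/RankDefectRepresentations/Lines/rank-dehn-ladder-A-problem.md`).  Rows `x : ι` and columns `y : ι'` carry
cube colours `row x, col y : Fin n → Bool`; the `j`-th cut of `R` is `R ∘ 1[row_j ≠ col_j]`, of rank `≤ t`.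

THE OBSERVATION (lead g6, A-problem.md §9).  For ANY weight matrices `W_j` put `D := ∑_j 1[row_j ≠ col_j] ∘ W_j`.
Then `R ⊙ D = ∑_j (cut_j R) ⊙ W_j`, so `rank (R ⊙ D) ≤ t · ∑_j rank W_j` (Hadamard rank is submultiplicative,
`Literature.LinearAlgebra.Matrix.HadamardProductRank.rank_hadamard_le`); and if `D ⊙ E` is the all-ones matrix then
`R = E ⊙ (R ⊙ D)`, whence

  `rank R ≤ rank E · t · ∑_j rank W_j`        (`rank_le_of_hadamardCertificate`).

The g2 certificates (`…CutLemmaRankOneCuts`, `…CutLemmaCharacterCuts`) are the case `D = 𝟙 = E`.  The new freedom is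
that `D` need only be entrywise INVERTIBLE with an entrywise inverse `E` of small rank.  With `W_j = 𝟙` the matrix `D`
is the Hamming-distance matrix `d(row x, col y)` (nowhere zero iff the rectangle is colour-disjoint and the
characteristic is `0` or exceeds `n`), so

  `rank R ≤ rank (1/d(row x, col y))_{x,y} · n · t`     (`rank_le_rank_recipDist_mul`),

and in particular the ADDITIVE cut conjecture (A) holds, with constant `n` in the max-`t` normalisation, whenever all
row–column distances are equal (`rank_le_of_equidistant`); more generally the constant is polynomial whenever the
distance spectrum is bounded (the reciprocal is then a bounded-degree polynomial in the distance matrix, whose rank is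
`≤ n + 2`) — not formalised here.
HONEST FRAMING: a new proved regime and a cleaner certificate notion for one rung; the cut lemma, the crux and P ≠ NP
are not touched; F-N2 is a FRONTIER formal rung.
-/

set_option linter.dupNamespace false -- `Summit.PneNP.PneNP.…`: summit = sub-problem name (D-0017)

namespace Summit.PneNP.PneNP.Theorems.CnfIdealGenLengthRankDefectRepresentationsCutLemmaReciprocal

open Finset
open scoped Matrix
open Literature.Computability.AlgebraicComplexity (rank_sum_le)
open Literature.LinearAlgebra.Matrix.HadamardProductRank (rank_hadamard_le)

variable {K : Type} [Field K] {n : ℕ} {ι ι' : Type} [Fintype ι] [Fintype ι']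

omit [Fintype ι] [Fintype ι'] in
/-- `R ⊙ D = ∑_j (cut_j R) ⊙ W_j` for the weighted cut sum `D = ∑_j 1[row_j ≠ col_j] ∘ W_j`. -/
theorem hadamard_cutSum (row : ι → Fin n → Bool) (col : ι' → Fin n → Bool) (W : Fin n → Matrix ι ι' K)
    (R : Matrix ι ι' K) :
    R ⊙ (Matrix.of fun x y => ∑ j, if row x j ≠ col y j then W j x y else 0) =
      ∑ j, (Matrix.of fun x y => if row x j ≠ col y j then R x y else 0) ⊙ W j := by
  ext x y
  simp only [Matrix.hadamard_apply, Matrix.of_apply, Matrix.sum_apply, Finset.mul_sum]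
  refine Finset.sum_congr rfl fun j _ => ?_
  split_ifs <;> simp

/-- `rank (R ⊙ D) ≤ t · ∑_j rank W_j` when every cut of `R` has rank `≤ t`. -/
theorem rank_hadamard_cutSum_le (row : ι → Fin n → Bool) (col : ι' → Fin n → Bool) (W : Fin n → Matrix ι ι' K)
    (R : Matrix ι ι' K) (t : ℕ) (ht : ∀ j, (Matrix.of fun x y => if row x j ≠ col y j then R x y else 0).rank ≤ t) :
    (R ⊙ (Matrix.of fun x y => ∑ j, if row x j ≠ col y j then W j x y else 0)).rank ≤ t * ∑ j, (W j).rank := by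
  rw [hadamard_cutSum, Finset.mul_sum]
  refine (rank_sum_le _ _).trans (Finset.sum_le_sum fun j _ => ?_)
  exact (rank_hadamard_le _ _).trans (Nat.mul_le_mul_right _ (ht j))

/-- HADAMARD CERTIFICATE.  If `D ⊙ E = 𝟙` entrywise, `D` the weighted cut sum `∑_j 1[row_j ≠ col_j] ∘ W_j`, and every
cut of `R` has rank `≤ t`, then `rank R ≤ rank E · (t · ∑_j rank W_j)`. -/
theorem rank_le_of_hadamardCertificate (row : ι → Fin n → Bool) (col : ι' → Fin n → Bool)
    (W : Fin n → Matrix ι ι' K) (E : Matrix ι ι' K)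
    (hE : ∀ x y, (∑ j, if row x j ≠ col y j then W j x y else 0) * E x y = 1)
    (R : Matrix ι ι' K) (t : ℕ) (ht : ∀ j, (Matrix.of fun x y => if row x j ≠ col y j then R x y else 0).rank ≤ t) :
    R.rank ≤ E.rank * (t * ∑ j, (W j).rank) := by
  have hR : R = E ⊙ (R ⊙ (Matrix.of fun x y => ∑ j, if row x j ≠ col y j then W j x y else 0)) := by
    ext x y
    simp only [Matrix.hadamard_apply, Matrix.of_apply]
    calc R x y = R x y * ((∑ j, if row x j ≠ col y j then W j x y else 0) * E x y) := by rw [hE, mul_one]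
      _ = E x y * (R x y * ∑ j, if row x j ≠ col y j then W j x y else 0) := by ring
  calc R.rank = (E ⊙ (R ⊙ (Matrix.of fun x y => ∑ j, if row x j ≠ col y j then W j x y else 0))).rank := by
        rw [← hR]
    _ ≤ E.rank * (R ⊙ (Matrix.of fun x y => ∑ j, if row x j ≠ col y j then W j x y else 0)).rank :=
        rank_hadamard_le _ _
    _ ≤ E.rank * (t * ∑ j, (W j).rank) := Nat.mul_le_mul_left _ (rank_hadamard_cutSum_le row col W R t ht)

/-! ## Reciprocal distances -/

omit [Fintype ι] [Fintype ι'] in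
/-- With all weights `𝟙`, the cut sum is the Hamming-distance matrix `d(row x, col y)`. -/
theorem cutSum_one (row : ι → Fin n → Bool) (col : ι' → Fin n → Bool) (x : ι) (y : ι') :
    (∑ j, if row x j ≠ col y j then (Matrix.of fun (_ : ι) (_ : ι') => (1 : K)) x y else 0) =
      ((Finset.univ.filter fun j : Fin n => row x j ≠ col y j).card : K) := by
  simp only [Matrix.of_apply]
  rw [Finset.card_filter]
  push_cast
  rfl

omit [Fintype ι] in
/-- The all-ones matrix has rank `≤ 1`. -/
theorem rank_of_one_le : (Matrix.of fun (_ : ι) (_ : ι') => (1 : K)).rank ≤ 1 := by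
  have h : (Matrix.of fun (_ : ι) (_ : ι') => (1 : K)) = Matrix.vecMulVec (fun _ => 1) (fun _ => 1) := by
    ext x y; simp [Matrix.vecMulVec_apply]
  rw [h]; exact Matrix.rank_vecMulVec_le _ _

/-- RECIPROCAL-DISTANCE BOUND.  If every row–column Hamming distance `d(row x, col y)` is nonzero in `K` (e.g. the
rectangle is colour-disjoint and `K` has characteristic `0`), and every cut of `R` has rank `≤ t`, then
`rank R ≤ rank (1/d(row x, col y))_{x,y} · (n · t)`. -/
theorem rank_le_rank_recipDist_mul (row : ι → Fin n → Bool) (col : ι' → Fin n → Bool)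
    (hd : ∀ x y, ((Finset.univ.filter fun j : Fin n => row x j ≠ col y j).card : K) ≠ 0) (R : Matrix ι ι' K)
    (t : ℕ) (ht : ∀ j, (Matrix.of fun x y => if row x j ≠ col y j then R x y else 0).rank ≤ t) :
    R.rank ≤ (Matrix.of fun x y =>
      (((Finset.univ.filter fun j : Fin n => row x j ≠ col y j).card : K))⁻¹).rank * (n * t) := by
  have h := rank_le_of_hadamardCertificate row col (fun _ => Matrix.of fun _ _ => (1 : K))
    (Matrix.of fun x y => (((Finset.univ.filter fun j : Fin n => row x j ≠ col y j).card : K))⁻¹)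
    (fun x y => by rw [cutSum_one, Matrix.of_apply]; exact mul_inv_cancel₀ (hd x y)) R t ht
  refine h.trans (Nat.mul_le_mul_left _ ?_)
  rw [mul_comm]
  refine Nat.mul_le_mul_right _ ?_
  calc ∑ _j : Fin n, (Matrix.of fun (_ : ι) (_ : ι') => (1 : K)).rank ≤ ∑ _j : Fin n, 1 :=
        Finset.sum_le_sum fun _ _ => rank_of_one_le
    _ = n := by simp

/-- EQUIDISTANT REGIME: if all row–column Hamming distances equal some `d` with `(d : K) ≠ 0` (in characteristic `0`:
the rectangle is colour-disjoint and equidistant) and every cut of `R` has rank `≤ t`, then the additive cut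
conjecture (A) holds for `R`: `rank R ≤ n · t`. -/
theorem rank_le_of_equidistant (row : ι → Fin n → Bool) (col : ι' → Fin n → Bool) (d : ℕ) (hdK : (d : K) ≠ 0)
    (hd : ∀ x y, (Finset.univ.filter fun j : Fin n => row x j ≠ col y j).card = d) (R : Matrix ι ι' K) (t : ℕ)
    (ht : ∀ j, (Matrix.of fun x y => if row x j ≠ col y j then R x y else 0).rank ≤ t) :
    R.rank ≤ n * t := by
  have h := rank_le_rank_recipDist_mul row col (fun x y => by rw [hd]; exact hdK) R t ht
  have hE : (Matrix.of fun x y =>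
      (((Finset.univ.filter fun j : Fin n => row x j ≠ col y j).card : K))⁻¹).rank ≤ 1 := by
    have : (Matrix.of fun x y => (((Finset.univ.filter fun j : Fin n => row x j ≠ col y j).card : K))⁻¹) =
        Matrix.vecMulVec (fun _ : ι => ((d : K))⁻¹) (fun _ : ι' => 1) := by
      ext x y; simp [Matrix.vecMulVec_apply, hd]
    rw [this]; exact Matrix.rank_vecMulVec_le _ _
  calc R.rank ≤ _ := h
    _ ≤ 1 * (n * t) := Nat.mul_le_mul_right _ hE
    _ = n * t := one_mul _

/-! ## Bounded distance spectrum -/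

/-- Rank is subadditive (two summands; from `rank_sum_le`). -/
theorem rank_add_le' (A B : Matrix ι ι' K) : (A + B).rank ≤ A.rank + B.rank := by
  have h : A + B = ∑ b : Bool, (if b then A else B) := by simp
  rw [h]
  refine (rank_sum_le _ _).trans ?_
  rw [Fintype.sum_bool]
  simp

/-- A single cut mask `1[row_j ≠ col_j]` has rank `≤ 2` (it is the sum of two rank-one rectangles). -/
theorem rank_cutMask_le [DecidableEq ι'] (row : ι → Fin n → Bool) (col : ι' → Fin n → Bool) (j : Fin n) :
    (Matrix.of fun x y => if row x j ≠ col y j then (1 : K) else 0).rank ≤ 2 := by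
  have h : (Matrix.of fun x y => if row x j ≠ col y j then (1 : K) else 0) =
      Matrix.vecMulVec (fun x => if row x j then (1 : K) else 0) (fun y => if col y j then 0 else 1) +
        Matrix.vecMulVec (fun x => if row x j then (0 : K) else 1) (fun y => if col y j then 1 else 0) := by
    ext x y
    simp only [Matrix.of_apply, Matrix.add_apply, Matrix.vecMulVec_apply]
    cases row x j <;> cases col y j <;> simp
  rw [h]
  exact (rank_add_le' _ _).trans (Nat.add_le_add (Matrix.rank_vecMulVec_le _ _) (Matrix.rank_vecMulVec_le _ _))

/-- The Hamming-distance matrix `d(row x, col y)` has rank `≤ 2 n`. -/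
theorem rank_dist_le [DecidableEq ι'] (row : ι → Fin n → Bool) (col : ι' → Fin n → Bool) :
    (Matrix.of fun x y => (((Finset.univ.filter fun j : Fin n => row x j ≠ col y j).card : ℕ) : K)).rank
      ≤ 2 * n := by
  have h : (Matrix.of fun x y => (((Finset.univ.filter fun j : Fin n => row x j ≠ col y j).card : ℕ) : K)) =
      ∑ j : Fin n, Matrix.of fun x y => if row x j ≠ col y j then (1 : K) else 0 := by
    ext x y
    rw [Matrix.of_apply, ← cutSum_one row col x y, Matrix.sum_apply]
    simp only [Matrix.of_apply]
  rw [h]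
  refine (rank_sum_le _ _).trans ?_
  calc ∑ j : Fin n, (Matrix.of fun x y => if row x j ≠ col y j then (1 : K) else 0).rank ≤ ∑ _j : Fin n, 2 :=
        Finset.sum_le_sum fun j _ => rank_cutMask_le row col j
    _ = 2 * n := by simp [mul_comm]

/-- Entrywise powers of the distance matrix: `rank (d^{∘i}) ≤ (2n)^i`. -/
theorem rank_distPow_le [DecidableEq ι'] (row : ι → Fin n → Bool) (col : ι' → Fin n → Bool) (i : ℕ) :
    (Matrix.of fun x y =>
      (((Finset.univ.filter fun j : Fin n => row x j ≠ col y j).card : ℕ) : K) ^ i).rank ≤ (2 * n) ^ i := by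
  induction i with
  | zero =>
    simp only [pow_zero]
    exact rank_of_one_le
  | succ i ih =>
    have h : (Matrix.of fun x y =>
        (((Finset.univ.filter fun j : Fin n => row x j ≠ col y j).card : ℕ) : K) ^ (i + 1)) =
        (Matrix.of fun x y => (((Finset.univ.filter fun j : Fin n => row x j ≠ col y j).card : ℕ) : K) ^ i) ⊙
          (Matrix.of fun x y => (((Finset.univ.filter fun j : Fin n => row x j ≠ col y j).card : ℕ) : K)) := by
      ext x y; simp [Matrix.hadamard_apply, pow_succ]
    rw [h, pow_succ]
    exact (rank_hadamard_le _ _).trans (Nat.mul_le_mul ih (rank_dist_le row col))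

omit [Fintype ι'] in
/-- Scalar multiples do not increase rank. -/
theorem rank_smul_le' [Fintype ι'] [DecidableEq ι] (c : K) (M : Matrix ι ι' K) : (c • M).rank ≤ M.rank := by
  rw [Matrix.smul_eq_diagonal_mul]
  exact Matrix.rank_mul_le_right _ _

/-- BOUNDED DISTANCE SPECTRUM.  If the row–column Hamming distances take values in a set `V` of `k` NONZERO scalars
(in characteristic `0`: a colour-disjoint rectangle with `k` distinct distances) and every cut of `R` has rank `≤ t`,
then `rank R ≤ (∑_{i<k} (2n)^i) · n · t` — a polynomial constant for bounded `k`; `k = 1` is the equidistant regime.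
PROOF: Lagrange-interpolate `v ↦ v⁻¹` on `V` by a polynomial `q` of degree `< k`; then `1/d = q(d)` entrywise is a
combination of the Hadamard powers `d^{∘i}`, `i < k`, of rank `≤ (2n)^i` each, and `rank_le_rank_recipDist_mul` applies. -/
theorem rank_le_of_distSpectrum [DecidableEq ι] [DecidableEq ι'] (row : ι → Fin n → Bool)
    (col : ι' → Fin n → Bool) (V : Finset K) (hV0 : (0 : K) ∉ V)
    (hd : ∀ x y, (((Finset.univ.filter fun j : Fin n => row x j ≠ col y j).card : ℕ) : K) ∈ V)
    (R : Matrix ι ι' K) (t : ℕ) (ht : ∀ j, (Matrix.of fun x y => if row x j ≠ col y j then R x y else 0).rank ≤ t) :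
    R.rank ≤ (∑ i ∈ Finset.range V.card, (2 * n) ^ i) * (n * t) := by
  classical
  rcases V.eq_empty_or_nonempty with hV | hV
  · have hR : R = 0 := by
      ext x y; exact absurd (hd x y) (by simp [hV])
    simp [hR]
  -- the interpolating polynomial of `v ↦ v⁻¹` on `V`
  set q : Polynomial K := Lagrange.interpolate V id fun v => v⁻¹ with hq
  have hinj : Set.InjOn (id : K → K) (V : Set K) := Set.injOn_id _
  have hqeval : ∀ v ∈ V, q.eval v = v⁻¹ := fun v hv => by
    have := Lagrange.eval_interpolate_at_node (r := fun v : K => v⁻¹) hinj hv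
    simpa only [id_eq, ← hq] using this
  have hqdeg : q.natDegree < V.card := by
    by_cases hq0 : q = 0
    · rw [hq0, Polynomial.natDegree_zero]; exact Finset.card_pos.mpr hV
    · exact (Polynomial.natDegree_lt_iff_degree_lt hq0).mpr (Lagrange.degree_interpolate_lt _ hinj)
  have hdne : ∀ x y, (((Finset.univ.filter fun j : Fin n => row x j ≠ col y j).card : ℕ) : K) ≠ 0 :=
    fun x y h0 => hV0 (h0 ▸ hd x y)
  -- the entrywise inverse of the distance matrix is `q(d)`, a combination of Hadamard powers
  have hE : (Matrix.of fun x y => ((((Finset.univ.filter fun j : Fin n => row x j ≠ col y j).card : ℕ) : K))⁻¹) =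
      ∑ i ∈ Finset.range V.card, q.coeff i • (Matrix.of fun x y =>
        (((Finset.univ.filter fun j : Fin n => row x j ≠ col y j).card : ℕ) : K) ^ i) := by
    ext x y
    rw [Matrix.of_apply, ← hqeval _ (hd x y), Polynomial.eval_eq_sum_range' hqdeg, Matrix.sum_apply]
    simp only [Matrix.smul_apply, Matrix.of_apply, smul_eq_mul]
  have hErank : (Matrix.of fun x y =>
      ((((Finset.univ.filter fun j : Fin n => row x j ≠ col y j).card : ℕ) : K))⁻¹).rank ≤
      ∑ i ∈ Finset.range V.card, (2 * n) ^ i := by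
    rw [hE]
    refine (rank_sum_le _ _).trans (Finset.sum_le_sum fun i _ => ?_)
    exact (rank_smul_le' _ _).trans (rank_distPow_le row col i)
  exact (rank_le_rank_recipDist_mul row col hdne R t ht).trans (Nat.mul_le_mul_right _ hErank)

end Summit.PneNP.PneNP.Theorems.CnfIdealGenLengthRankDefectRepresentationsCutLemmaReciprocal
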